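import Summits.BirchSwinnertonDyer.Rank1Residual.ManinAdditive.ThetaFourOmega
import Summits.BirchSwinnertonDyer.Rank1Residual.ManinAdditive.NeronOmegaGenus
import HarnessLib
import HarnessLib.Audit.Tags

/-!
# Theta series of the θ₄-Brandt module in `Ω₃(9p)`: the cusp-by-cusp split of E-desc-156
(cell bsd-f2-manin, desc lens g22, MEMO-desc §47.10/§47.12; SIBLING of the landed `ThetaFourOmega.lean` (p739781 + p740055),
same namespace; nothing under `@[conjecture]` is asserted; everything else is PROVED bookkeeping).

CONTENT.  (1) PROVED membership criterion `mem_omegaLatticeAtThree_of` for imc's `Ω₃(N) = NeronOmegaThree.omegaLatticeAtThree N`: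
the three cusp conditions (C_0) `w x` 3-integral, (C_1) `w (t₃ x)` of `(1−ζ₃)`-valuation `≥ −1`, (C_2) (only if `27 ∣ N`), checked on
ONE integral cusp form, put it in `Ω₃(N)` (each condition is stable under `ℤ`-multiples: `isEisensteinIntegral_zsmul`,
`isPiIntegralUpToDifferent_zsmul`, imc's `isThreeIntegral_zsmul`).  (2) PROVED E-desc-156α `IsThetaPair.mem_integralCuspForms0`.
(3) E-blind rows (nothing asserted): E-desc-156β `ThetaPairCuspZeroIntegralAtNinePrime` (cusp `0`), E-desc-156γ
`ThetaPairCuspThirdPiIntegralAtNinePrime` (cusp `1/3` = ONE local Weil-representation coefficient for the quaternary lattice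
`U ⊥ 3U` at 3), E-desc-156β⁺ `ThetaPairAtkinLehnerClosedAtNinePrime` (`w₉` maps theta pairs to theta pairs).  (4) PROVED
assemblies `thetaFourOmegaIntegral_of_cusps : 156β → 156γ → ThetaFourOmegaIntegralAtNinePrime` and
`thetaPairCuspZeroIntegral_of_closed : 156β⁺ → 156β`.

CENSUS = BC5 WITNESS (kit jobs tag bsd; engine imc ENGINE 7 `neronomega.gp` + desc patches `nb/neronomega_theta*.gp`, data
`nb/theta9*.gp` from `nb/theta9.py`; HOME/desc/g22/nb/THETA-OMEGA-table.md): Ω₃-membership of theta pairs 2046/2046 orbit vectors +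
64/64 point series at 19 levels `9M` (`M ≤ 61`, incl. the pre-registered out-of-sample levels 477, 495, 549: 826/826, j335211);
`w₉`-permutation of the theta set 1220/1220 at 16 levels, theta lattice `w₉`-stable over `ℤ` at 16/16, `w₉² = 1`, `det = −1`
(j335315, j335322).  PARTITION 0 · beyond-print theorem: no · `3 ∤ c_E` is NOT proved by this; BSD is not proved by this; C3 OPEN.

TYPER NOTE (typer g21, T-desc-41).  SOURCE = HOME/desc/g22/Sketch-desc-g22b.lean sha16 3381ec6cd7e70887 (187 l.; desc: farm rc 0 · 0 err · 0 warn ·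
0 sorry; BC7 3/3 CLEAN f43c245f7f195900 vs `ManinLocalTwoThree.ManinPrimeToThreeAtNine`; MEMO-desc §47.10/§47.12, HOME/desc/g22/memo47.md; pack
HOME/desc/g22/SHA16SUMS.desc.g22) VERBATIM — desc's header above, every body and docstring below; the only typer delta is this note.  WHY A
SIBLING: the tree's `ThetaFourOmega.lean` is Sketch-desc-g22 v1 (p739781) + the v2 `section Glue` append (p740055); desc's v3/v4 deltas were
re-packaged by desc as this NEW file (typer 19:18Z rule: deltas after landing = new siblings or explicit appends).  Imports: landed
`…ManinAdditive.ThetaFourOmega` + `…ManinAdditive.NeronOmegaGenus` (both Theses-free; closure 12 + 17 Summits modules) + HarnessLib(+Audit.Tags) —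
route-independent; namespace `…ManinAdditive.ThetaFourOmega` (same as the parent file).  CONTENT: PROVED support `isEisensteinIntegral_zsmul/_zero`,
`isPiIntegralUpToDifferent_zsmul/_zero`, **`mem_omegaLatticeAtThree_of`** (membership criterion for imc's `Ω₃(N) = NeronOmegaThree.omegaLatticeAtThree N`
from the three cusp conditions on ONE integral form; cf. imc's landed `mem_omegaLatticeAtThree_of_fricke_eigen`, p740329), PROVED E-desc-156α
`IsThetaPair.mem_integralCuspForms0`; ROWS (desc's `@[conjecture]` tags, E-blind, nothing asserted): **E-desc-156β `ThetaPairCuspZeroIntegralAtNinePrime`**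
(cusp 0), **E-desc-156γ `ThetaPairCuspThirdPiIntegralAtNinePrime`** (cusp 1/3 — one local Weil-representation coefficient for `U ⊥ 3U`; data ask
D-desc-36 (iv)), **E-desc-156β⁺ `ThetaPairAtkinLehnerClosedAtNinePrime`** (`w₉` permutes theta pairs); PROVED assemblies
`thetaFourOmegaIntegral_of_cusps : 156β → 156γ → ThetaFourOmegaIntegralAtNinePrime` (E-desc-156 of the parent file) and
`thetaPairCuspZeroIntegral_of_closed : 156β⁺ → 156β`.  BC5 (desc, kit j334928/j334966/j335022/j335211/j335315/j335322, engine imc ENGINE 7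
neronomega.gp + desc patches): Ω₃-membership 2046/2046 orbit vectors + 64/64 point series at 19 levels 9M (M ≤ 61, incl. pre-registered 477/495/549:
826/826); w₉-permutation 1220/1220 at 16 levels; 0 violations.  REFUTER: ref1/ref2 R-desc-38 (extended to 156β/γ) PENDING at landing.  Typer
checks: 11 decl names fresh tree-wide; cite keys CremonaEcdata / Pizer1980 in references.bib; no instances, no notation, no sorry.  PARTITION 0 ·
beyond-print theorem: no · bears_on: stmt-BirchSwinnertonDyer-22968 (C3 `ManinPrimeToThreeAtNine`).  `3 ∤ c_E` is NOT proved by this; BSD is not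
proved by this; C3 OPEN.
-/

namespace Summit.BirchSwinnertonDyer.Rank1Residual.ManinAdditive.ThetaFourOmega

open scoped MatrixGroups ModularForm
open CongruenceSubgroup WeierstrassCurve Literature.NumberTheory.EllipticCurves
open Literature.NumberTheory.EllipticCurves.ModularForms
open Summit.BirchSwinnertonDyer.Rank1Residual.ManinAdditive.HurwitzBrandt (DQuat)
open Summit.BirchSwinnertonDyer.Rank1Residual.ManinAdditive.ThetaFourBrandt
open Summit.BirchSwinnertonDyer.Rank1Residual.ManinAdditive.NeronOmegaThree

/-! ### The cusp-by-cusp split of E-desc-156 -/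

section OmegaMembership

open Summit.BirchSwinnertonDyer.Rank1Residual.ManinAdditive.NeronCuspThree
  Summit.BirchSwinnertonDyer.Rank1Residual.ManinAdditive.NeronOmegaGenus
  Summit.BirchSwinnertonDyer.Rank1Residual.ManinAdditive.ConwayNortonThree

variable {N : ℕ} [NeZero N]

omit [NeZero N] in
/-- `IsEisensteinIntegral` is stable under integer multiples. [folklore] -/
theorem isEisensteinIntegral_zsmul {x : CuspForm (Gamma0 N) 2} (hx : IsEisensteinIntegral N x) (n : ℤ) :
    IsEisensteinIntegral N (n • x) := by
  obtain ⟨y, hy, z, hz, rfl⟩ := hx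
  exact ⟨n • y, Submodule.smul_mem _ n hy, n • z, Submodule.smul_mem _ n hz, by rw [smul_add, smul_comm n zeta3 z]⟩

omit [NeZero N] in
/-- `0` is `ℤ[ζ₃]`-integral. [folklore] -/
theorem isEisensteinIntegral_zero : IsEisensteinIntegral N (0 : CuspForm (Gamma0 N) 2) :=
  ⟨0, zero_mem _, 0, zero_mem _, by simp⟩

omit [NeZero N] in
/-- `IsPiIntegralUpToDifferent` is stable under integer multiples. [folklore] -/
theorem isPiIntegralUpToDifferent_zsmul {y : CuspForm (Gamma0 N) 2} (hy : IsPiIntegralUpToDifferent N y) (n : ℤ) :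
    IsPiIntegralUpToDifferent N (n • y) := by
  obtain ⟨m, hm, hE⟩ := hy
  refine ⟨m, hm, ?_⟩
  rw [smul_comm (1 - zeta3) n y, smul_comm (m : ℂ) n _]
  exact isEisensteinIntegral_zsmul hE n

omit [NeZero N] in
/-- `0` satisfies the différent allowance. [folklore] -/
theorem isPiIntegralUpToDifferent_zero : IsPiIntegralUpToDifferent N (0 : CuspForm (Gamma0 N) 2) :=
  ⟨1, by norm_num, by rw [smul_zero, smul_zero]; exact isEisensteinIntegral_zero⟩

/-- **Membership criterion for `Ω₃(N)` (PROVED; the three cusp conditions (C_0), (C_1), (C_2) of the definition, checked on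
ONE integral form, put it in the lattice — because each condition is stable under `ℤ`-multiples).** [folklore] -/
theorem mem_omegaLatticeAtThree_of {x : CuspForm (Gamma0 N) 2} (hx : x ∈ integralCuspForms0 N 2)
    (h0 : IsThreeIntegral N (atkinLehnerInvolutionAt N 2 3 x))
    (h1 : IsPiIntegralUpToDifferent N (atkinLehnerInvolutionAt N 2 3 (thirdTranslate N 2 1 x)))
    (h2 : 27 ∣ N → IsPiIntegralUpToDifferent N
      (atkinLehnerInvolutionAt N 2 3 (thirdTranslate N 2 1 (atkinLehnerInvolutionAt N 2 3 x)))) :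
    x ∈ omegaLatticeAtThree N := by
  have hle : Submodule.span ℤ {x} ≤ omegaLatticeAtThree N := by
    refine le_sSup ⟨Submodule.span_le.mpr (Set.singleton_subset_iff.mpr hx), fun y hy => ?_⟩
    obtain ⟨n, rfl⟩ := Submodule.mem_span_singleton.mp hy
    refine ⟨?_, ?_, fun h27 => ?_⟩
    · rw [map_zsmul]
      exact isThreeIntegral_zsmul h0 n
    · rw [map_zsmul, map_zsmul]
      exact isPiIntegralUpToDifferent_zsmul h1 n
    · rw [map_zsmul, map_zsmul, map_zsmul]
      exact isPiIntegralUpToDifferent_zsmul (h2 h27) n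
  exact hle (Submodule.mem_span_singleton_self x)

omit [NeZero N] in
/-- **E-desc-156α (PROVED): a theta pair has integral `q`-expansions** (`a₀ = 0` for cusp forms; `aₙ`, `n ≥ 1`, are the
real / imaginary parts of Gaussian integers). [folklore] -/
theorem IsThetaPair.mem_integralCuspForms0 {e p : ℕ} {u : Fin (p + 1) → ZI} {x : Fin (p + 1)}
    {Θ₁ Θ₂ : CuspForm (Gamma0 N) 2} (h : IsThetaPair e p N u x Θ₁ Θ₂) :
    Θ₁ ∈ integralCuspForms0 N 2 ∧ Θ₂ ∈ integralCuspForms0 N 2 := by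
  refine ⟨fun n => ?_, fun n => ?_⟩
  · rcases Nat.eq_zero_or_pos n with rfl | hn
    · exact ⟨0, by rw [Int.cast_zero, cuspCoeff_zero (one_mem_strictPeriods_coe_gamma0 N)]⟩
    · exact ⟨(thetaCoeff12 e p n u x).1, ((h n hn).1).symm⟩
  · rcases Nat.eq_zero_or_pos n with rfl | hn
    · exact ⟨0, by rw [Int.cast_zero, cuspCoeff_zero (one_mem_strictPeriods_coe_gamma0 N)]⟩
    · exact ⟨(thetaCoeff12 e p n u x).2, ((h n hn).2).symm⟩

/-- **Row E-desc-156β `ThetaPairCuspZeroIntegralAtNinePrime`** (E-blind cusp row (C_0); desc g22 addendum; nothing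
asserted): `w₉` of a theta pair of the level-`9p` special order is `3`-adically integral at `∞` — i.e. the pair is
`3`-integral at the cusp `0` (`Θ ∈ L_red(9p)`).  Mechanism on paper: `w₉` restricted to the `θ₄^e`-modules is the
translation by a uniformiser `π_D` of `B_{3,∞} ⊗ ℚ₃` (the whole of `D^×` normalises the special order `{x : x̄ ∈ 𝔽₃}`), which
maps `Θ^{(e)}_{u,x}` to a unit multiple of a theta series of the Frobenius-conjugate character `θ₄^{3e}`.  Census (kit
j334928/j334966/j335022/j335211, column `inS_Z3`/`L_red`): 2046/2046 orbit vectors + 64/64 point series at 19 levels.  Why it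
might fail: the unit is a Gauss sum `g(θ₄^e)/3` whose `3`-adic valuation is `0` only for one of the two conjugate modules.
[cite: CremonaEcdata] [cite: Pizer1980, Thm. 2.26 (shape)] -/
@[conjecture]
def ThetaPairCuspZeroIntegralAtNinePrime : Prop :=
  ∀ (p e : ℕ) [NeZero (9 * p)], p.Prime → 5 ≤ p → (e = 1 ∨ e = 2) →
  ∀ (u : Fin (p + 1) → ZI) (x : Fin (p + 1)) (Θ₁ Θ₂ : CuspForm (Gamma0 (9 * p)) 2),
    IsThetaPair e p (9 * p) u x Θ₁ Θ₂ →
    IsThreeIntegral (9 * p) (atkinLehnerInvolutionAt (9 * p) 2 3 Θ₁) ∧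
      IsThreeIntegral (9 * p) (atkinLehnerInvolutionAt (9 * p) 2 3 Θ₂)

/-- **Row E-desc-156γ `ThetaPairCuspThirdPiIntegralAtNinePrime`** (E-blind cusp row (C_1); desc g22 addendum; nothing
asserted): at the cusp `1/3` (multiplicity-2 component) a theta pair of the level-`9p` special order has `(1−ζ₃)`-adic
valuation `≥ −1`: `w₉ (t₃ Θ)` times `(1−ζ₃)` is `3`-adically `ℤ[ζ₃]`-integral.  Mechanism on paper: `t₃ w₉ = diag(1,3) γ₀ diag(3,1)`
with `γ₀ ∈ SL₂(ℤ)` of lower-left entry prime to `3`, so the condition is the theta transformation formula of the quaternary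
norm-form lattice `L₃ ≅ U ⊥ 3U` (`U` unimodular anisotropic binary over `ℤ₃`) under the local Weil representation: the matrix
coefficient is `|L₃^♯/L₃|^{-1/2} ×` a Gauss sum over `(ℤ/3)²`, of `(1−ζ₃)`-valuation exactly `−1` — a FINITE LOCAL computation,
the same at every `p`.  Census (column `inLOmega` given `L_red`): 2046/2046 + 64/64 at 19 levels.  Why it might fail: the
local lattice of a non-principal right-ideal class at `3` differs from `O₃` (it does not: `D₃` has class number one), so the
only risk is the dictionary (D5) behind the allowance `−1`. [cite: CremonaEcdata] [cite: Pizer1980, Thm. 2.26 (shape)] -/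
@[conjecture]
def ThetaPairCuspThirdPiIntegralAtNinePrime : Prop :=
  ∀ (p e : ℕ) [NeZero (9 * p)], p.Prime → 5 ≤ p → (e = 1 ∨ e = 2) →
  ∀ (u : Fin (p + 1) → ZI) (x : Fin (p + 1)) (Θ₁ Θ₂ : CuspForm (Gamma0 (9 * p)) 2),
    IsThetaPair e p (9 * p) u x Θ₁ Θ₂ →
    IsPiIntegralUpToDifferent (9 * p) (atkinLehnerInvolutionAt (9 * p) 2 3 (thirdTranslate (9 * p) 2 1 Θ₁)) ∧
      IsPiIntegralUpToDifferent (9 * p) (atkinLehnerInvolutionAt (9 * p) 2 3 (thirdTranslate (9 * p) 2 1 Θ₂))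

/-- **PROVED: E-desc-156 ⟸ 156β ∧ 156γ** (with 156α and the membership criterion; `(C_2)` is vacuous since `27 ∤ 9p`). -/
theorem thetaFourOmegaIntegral_of_cusps (hβ : ThetaPairCuspZeroIntegralAtNinePrime)
    (hγ : ThetaPairCuspThirdPiIntegralAtNinePrime) : ThetaFourOmegaIntegralAtNinePrime := by
  intro p e _ hp h5 he u x Θ₁ Θ₂ hΘ
  have h27 : ¬ 27 ∣ 9 * p := by
    intro h
    have h3 : 3 ∣ p := by
      have : 3 * 9 ∣ p * 9 := by simpa [mul_comm] using h
      exact (Nat.mul_dvd_mul_iff_right (by norm_num : 0 < 9)).mp this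
    have := (Nat.prime_dvd_prime_iff_eq Nat.prime_three hp).mp h3
    omega
  obtain ⟨hi₁, hi₂⟩ := hΘ.mem_integralCuspForms0
  obtain ⟨h0₁, h0₂⟩ := hβ p e hp h5 he u x Θ₁ Θ₂ hΘ
  obtain ⟨h1₁, h1₂⟩ := hγ p e hp h5 he u x Θ₁ Θ₂ hΘ
  exact ⟨mem_omegaLatticeAtThree_of hi₁ h0₁ h1₁ fun h => absurd h h27,
    mem_omegaLatticeAtThree_of hi₂ h0₂ h1₂ fun h => absurd h h27⟩

/-- **Row E-desc-156β⁺ `ThetaPairAtkinLehnerClosedAtNinePrime`** (E-blind STRUCTURE row behind 156β; desc g22 addendum 47.12;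
nothing asserted): `w₉` maps a theta pair of the level-`9p` special order to a theta pair OF THE SAME character `θ₄^e` (the
image of `(u, x)` is some `(u', x')`; on paper `u' = ` a signed class-permutation of `u` and `x' = π_D·x`, because all of `D₃^×`
normalises the special order `{x ∈ O_D : x̄ ∈ 𝔽₃}` and `w₉` is defined over `ℚ`, hence commutes with coefficientwise complex
conjugation, so real parts go to real parts).  Census (kit j335315, tag bsd, engine = imc ENGINE 7 + desc patch
`nb/neronomega_theta_w.gp`): at all 16 levels `9M ≤ 441`: **1220/1220** orbit / cuspidal-basis theta vectors `y` have
`w₉ y = ± y'` for a theta vector `y'` of the same character and the same part (re/im) (402 of them `w₉`-eigenvectors), the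
theta lattice is `w₉`-stable over `ℤ` (both indices 1 at 16/16 levels), `w₉² = 1` and `det(w₉ | theta lattice) = −1` at 16/16
levels.  Why it might fail: for a `u` that is not a combination of orbit deltas with a COMMON sign pattern the image pair
could need `x'` depending on the source orbit (then only the weaker 156β survives). [cite: CremonaEcdata]
[cite: Pizer1980, Thm. 2.26 (shape)] -/
@[conjecture]
def ThetaPairAtkinLehnerClosedAtNinePrime : Prop :=
  ∀ (p e : ℕ) [NeZero (9 * p)], p.Prime → 5 ≤ p → (e = 1 ∨ e = 2) →
  ∀ (u : Fin (p + 1) → ZI) (x : Fin (p + 1)) (Θ₁ Θ₂ : CuspForm (Gamma0 (9 * p)) 2),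
    IsThetaPair e p (9 * p) u x Θ₁ Θ₂ →
    ∃ (u' : Fin (p + 1) → ZI) (x' : Fin (p + 1)),
      IsThetaPair e p (9 * p) u' x' (atkinLehnerInvolutionAt (9 * p) 2 3 Θ₁) (atkinLehnerInvolutionAt (9 * p) 2 3 Θ₂)

/-- PROVED: the structure row 156β⁺ implies the cusp-`0` row 156β (an image theta pair is integral by 156α). -/
theorem thetaPairCuspZeroIntegral_of_closed (h : ThetaPairAtkinLehnerClosedAtNinePrime) :
    ThetaPairCuspZeroIntegralAtNinePrime := by
  intro p e _ hp h5 he u x Θ₁ Θ₂ hΘ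
  obtain ⟨u', x', hΘ'⟩ := h p e hp h5 he u x Θ₁ Θ₂ hΘ
  obtain ⟨h₁, h₂⟩ := hΘ'.mem_integralCuspForms0
  exact ⟨⟨1, by norm_num, by rw [Nat.cast_one, one_smul]; exact h₁⟩,
    ⟨1, by norm_num, by rw [Nat.cast_one, one_smul]; exact h₂⟩⟩

end OmegaMembership

end Summit.BirchSwinnertonDyer.Rank1Residual.ManinAdditive.ThetaFourOmega
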